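import Mathlib
import HarnessLib
import Summits.ValiantsHypothesis.ValiantsHypothesis.Theorems.MonotoneRestorationOrbitRestorationQPSquaresSpan

/-!
# The untwisted part of a matrix-symmetric affine product splits off in span currency (reduction to the sign-twisted blocks)

Route MonotoneRestoration, crux `OrbitRestorationQP` (stmt-ValiantsHypothesis-18293), SPAN-currency lane of the open
sub-rung A_∞ (`stub_sigmaPiSigmaValue`), `ΠΣ` part.  Helper (`--supports`), def-free.  Refines
`NormalisedFactors.prod_mem_narrowSpan_of_supportBlockUntwisted` (all blocks untwisted ⇒ whole product narrow) to a
PARTIAL product: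

* **`prod_goodBlocks_mem_narrowSpan`** — let `C a · Π_i L_i ≠ 0` (degree-one factors) be invariant under all row/column
  renamings, with supports `R, S` as delivered by `LocalFactors.exists_rowColSupports_of_matrixSymmetric`, and let
  `Good` be any class of support labels `(A, T)` closed under `(A, T) ↦ (σ • A, τ • T)`.  If every `Good` support block is
  untwisted (no renaming rescales it non-trivially), then the product of the factors with `Good` labels lies in
  `span_ℂ {hom_{F,n} : tw F ≤ 2k − 1}` — WITHOUT any invariance hypothesis on this partial product (the cocycle
  trivialisation `exists_rescaling_of_eigenFree_transport` needs only transport up to units and eigen-freeness).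

Consequence (the exact residue of span-A₁): with `Good` := "block not sign-twisted" (closed under the action since block
eigen-characters are transported by conjugation), `f = F_good · F_sign` with `F_good ∈ span`; since the span is closed
under products (`NarrowSpanAlgebra.narrowSpan_mul_mem`), `f ∈ span` as soon as the product `F_sign` of the SIGN-TWISTED
blocks is — the square-root problem R3 of `BLOCK-LANE-g7g5.md`.  No registered stub is closed; the crux and VP ≠ VNP are
not moved. [folklore]
-/

noncomputable section

open scoped Pointwise

-- `Summit.ValiantsHypothesis.ValiantsHypothesis.…` is the tree's single-conjunct layout (Sub = Summit).
set_option linter.dupNamespace false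

namespace Summit.ValiantsHypothesis.ValiantsHypothesis.Theorems

namespace NormalisedFactors

open MvPolynomial Finset Equiv ProductAction

variable {n : ℕ}

/-- **THE UNTWISTED PART SPLITS OFF IN SPAN CURRENCY.**  For any class `Good` of support labels closed under the
row/column action, if the `Good` support blocks are untwisted then the product of the factors with `Good` labels lies
in `span_ℂ {hom_{F,n} : tw F ≤ 2k − 1}` — no invariance of this partial product is needed.
[folklore; cite: DwivediPagoSeppelt2026, §8; DixonMortimer1996, Thm 5.2B] -/
theorem prod_goodBlocks_mem_narrowSpan {k : ℕ} (hk : 1 ≤ k) {ι : Type} [Fintype ι]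
    (L : ι → MvPolynomial (Fin n × Fin n) ℂ) (a : ℂ) (hL1 : ∀ i, (L i).totalDegree = 1) (hf0 : C a * ∏ i, L i ≠ 0)
    (hfix : ∀ σ τ : Perm (Fin n),
      rename (fun P : Fin n × Fin n => (σ P.1, τ P.2)) (C a * ∏ i, L i) = C a * ∏ i, L i)
    (R S : MvPolynomial (Fin n × Fin n) ℂ → Finset (Fin n))
    (R1 : ∀ (q : MvPolynomial (Fin n × Fin n) ℂ) (u : ℂ), u ≠ 0 → R (C u * q) = R q)
    (S1 : ∀ (q : MvPolynomial (Fin n × Fin n) ℂ) (u : ℂ), u ≠ 0 → S (C u * q) = S q)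
    (R2 : ∀ (q : MvPolynomial (Fin n × Fin n) ℂ) (σ : Perm (Fin n)), R (vact (K := ℂ) rowHom σ q) = σ • R q)
    (R3 : ∀ (q : MvPolynomial (Fin n × Fin n) ℂ) (τ : Perm (Fin n)), R (vact (K := ℂ) colHom τ q) = R q)
    (S2 : ∀ (q : MvPolynomial (Fin n × Fin n) ℂ) (τ : Perm (Fin n)), S (vact (K := ℂ) colHom τ q) = τ • S q)
    (S3 : ∀ (q : MvPolynomial (Fin n × Fin n) ℂ) (σ : Perm (Fin n)), S (vact (K := ℂ) rowHom σ q) = S q)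
    (hRk : ∀ i, (R (L i)).card < k) (hSk : ∀ i, (S (L i)).card < k)
    (hRfix : ∀ (i : ι) (ρ : Perm (Fin n)), (∀ x ∈ R (L i), ρ x = x) → vact (K := ℂ) rowHom ρ (L i) = L i)
    (hSfix : ∀ (i : ι) (ρ : Perm (Fin n)), (∀ x ∈ S (L i), ρ x = x) → vact (K := ℂ) colHom ρ (L i) = L i)
    (Good : Finset (Fin n) × Finset (Fin n) → Prop) [DecidablePred Good]
    (hGood : ∀ (σ τ : Perm (Fin n)) (l : Finset (Fin n) × Finset (Fin n)), Good l → Good (σ • l.1, τ • l.2))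
    (hblock : ∀ (σ τ : Perm (Fin n)) (l : Finset (Fin n) × Finset (Fin n)) (c : ℂ), Good l →
      rename (fun P : Fin n × Fin n => (σ P.1, τ P.2))
          (∏ i ∈ (univ : Finset ι).filter (fun i => (R (L i), S (L i)) = l), L i) =
        C c * ∏ i ∈ (univ : Finset ι).filter (fun i => (R (L i), S (L i)) = l), L i → c = 1) :
    (∏ i ∈ (univ : Finset ι).filter (fun i => Good (R (L i), S (L i))), L i) ∈
      Submodule.span ℂ {p : MvPolynomial (Fin n × Fin n) ℂ |
        ∃ (a b : ℕ) (E : Multiset (Fin a × Fin b)),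
          Literature.Combinatorics.SimpleGraph.treewidth (SimpleGraph.fromRel fun u v : Fin a ⊕ Fin b =>
            ∃ e ∈ E, u = Sum.inl e.1 ∧ v = Sum.inr e.2) ≤ 2 * k - 1 ∧
          p = Literature.Computability.AlgebraicComplexity.homPoly E n ℂ} := by
  classical
  have hL0 : ∀ i, L i ≠ 0 := by
    intro i h
    exact hf0 (by rw [Finset.prod_eq_zero (Finset.mem_univ i) h, mul_zero])
  -- labels and blocks
  set lab : MvPolynomial (Fin n × Fin n) ℂ → Finset (Fin n) × Finset (Fin n) := fun q => (R q, S q) with hlab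
  set J : Finset (Finset (Fin n) × Finset (Fin n)) :=
    ((univ : Finset ι).filter (fun i => Good (lab (L i)))).image (fun i => lab (L i)) with hJ
  set Blk : Finset (Fin n) × Finset (Fin n) → MvPolynomial (Fin n × Fin n) ℂ :=
    fun l => ∏ i ∈ (univ : Finset ι).filter (fun i => lab (L i) = l), L i with hBlk
  have hJgood : ∀ l ∈ J, Good l := by
    intro l hl
    rw [hJ, Finset.mem_image] at hl
    obtain ⟨i, hi, rfl⟩ := hl
    exact (Finset.mem_filter.1 hi).2
  have hdecomp : (∏ i ∈ (univ : Finset ι).filter (fun i => Good (lab (L i))), L i) = ∏ l ∈ J, Blk l := by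
    rw [← Finset.prod_fiberwise_of_maps_to (s := (univ : Finset ι).filter (fun i => Good (lab (L i)))) (t := J)
      (g := fun i => lab (L i)) (fun i hi => Finset.mem_image_of_mem _ hi) L]
    refine Finset.prod_congr rfl fun l hl => ?_
    rw [hBlk, Finset.filter_filter]
    congr 1
    refine Finset.filter_congr fun i _ => ?_
    constructor
    · rintro ⟨-, h⟩; exact h
    · intro h; exact ⟨by rw [h]; exact hJgood l hl, h⟩
  -- the label action
  have hlab_ren : ∀ (σ τ : Perm (Fin n)) (q : MvPolynomial (Fin n × Fin n) ℂ),
      lab (rename (fun P : Fin n × Fin n => (σ P.1, τ P.2)) q) = (σ • (lab q).1, τ • (lab q).2) := by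
    intro σ τ q
    simp only [hlab, rename_prod_eq, R2, R3, S3, S2]
  have hlab_unit : ∀ (q : MvPolynomial (Fin n × Fin n) ℂ) (u : ℂ), u ≠ 0 → lab (C u * q) = lab q := by
    intro q u hu
    simp only [hlab, R1 q u hu, S1 q u hu]
  have hact_inj : ∀ σ τ : Perm (Fin n), Function.Injective
      (fun l : Finset (Fin n) × Finset (Fin n) => (σ • l.1, τ • l.2)) := by
    intro σ τ l l' h
    simp only [Prod.mk.injEq] at h
    exact Prod.ext (smul_left_cancel σ h.1) (smul_left_cancel τ h.2)
  -- factor-level transport up to units (unique factorisation)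
  have hassoc : ∀ (σ τ : Perm (Fin n)) (i : ι), ∃ (i' : ι) (c : ℂ), c ≠ 0 ∧
      rename (fun P : Fin n × Fin n => (σ P.1, τ P.2)) (L i) = C c * L i' := by
    intro σ τ i
    have hrel := rel_associated_of_rename_prod_eq L a hL1 hf0 σ τ (hfix σ τ)
    have hmem : rename (fun P : Fin n × Fin n => (σ P.1, τ P.2)) (L i) ∈
        ((univ : Finset ι).val.map L).map (rename (fun P : Fin n × Fin n => (σ P.1, τ P.2))) :=
      Multiset.mem_map_of_mem _ (Multiset.mem_map_of_mem _ (Finset.mem_univ_val i))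
    obtain ⟨y, hy, hxy⟩ := Multiset.exists_mem_of_rel_of_mem hrel hmem
    obtain ⟨i', -, rfl⟩ := Multiset.mem_map.1 hy
    obtain ⟨c, hc0, hc⟩ := SupportBlocks.exists_C_of_associated hxy.symm
    exact ⟨i', c, hc0, hc⟩
  -- the action preserves the occurring labels
  have hmapsTo : ∀ (σ τ : Perm (Fin n)) (l : Finset (Fin n) × Finset (Fin n)), l ∈ J → (σ • l.1, τ • l.2) ∈ J := by
    intro σ τ l hl
    have hgl := hJgood l hl
    rw [hJ, Finset.mem_image] at hl ⊢
    obtain ⟨i, -, rfl⟩ := hl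
    obtain ⟨i', c, hc0, hc⟩ := hassoc σ τ i
    have hli' : lab (L i') = (σ • (lab (L i)).1, τ • (lab (L i)).2) := by
      rw [← hlab_unit (L i') c hc0, ← hc, hlab_ren]
    refine ⟨i', Finset.mem_filter.2 ⟨Finset.mem_univ _, ?_⟩, hli'⟩
    rw [hli']
    exact hGood σ τ _ hgl
  -- the block family indexed by the occurring labels
  set B : J → MvPolynomial (Fin n × Fin n) ℂ := fun l => Blk l.1 with hB
  have hB0 : ∀ l, B l ≠ 0 := fun l => Finset.prod_ne_zero_iff.2 fun i _ => hL0 i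
  set κf : Perm (Fin n) → Perm (Fin n) → J → J := fun σ τ l => ⟨(σ • l.1.1, τ • l.1.2), hmapsTo σ τ l.1 l.2⟩ with hκf
  have hκinj : ∀ σ τ, Function.Injective (κf σ τ) := by
    intro σ τ l l' h
    apply Subtype.ext
    have h' := congrArg Subtype.val h
    exact hact_inj σ τ h'
  set κ : Perm (Fin n) → Perm (Fin n) → Perm J := fun σ τ =>
    Equiv.ofBijective (κf σ τ) (Finite.injective_iff_bijective.1 (hκinj σ τ)) with hκ
  -- block transport up to units
  have hassocB : ∀ (σ τ : Perm (Fin n)) (l : J), ∃ c : ℂ, c ≠ 0 ∧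
      rename (fun P : Fin n × Fin n => (σ P.1, τ P.2)) (B l) = C c * B (κ σ τ l) := by
    intro σ τ l
    obtain ⟨c, hc0, hc⟩ := exists_unit_labelBlock_rowCol L a hL1 hf0 σ τ (hfix σ τ) lab
      (fun l : Finset (Fin n) × Finset (Fin n) => (σ • l.1, τ • l.2)) (hact_inj σ τ) hlab_unit
      (fun i => hlab_ren σ τ (L i)) l.1
    exact ⟨c, hc0, by simpa [hB, hBlk, hκ, hκf] using hc⟩
  have heigenB : ∀ (σ τ : Perm (Fin n)) (l : J) (c : ℂ),
      rename (fun P : Fin n × Fin n => (σ P.1, τ P.2)) (B l) = C c * B l → c = 1 :=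
    fun σ τ l c h => hblock σ τ l.1 c (hJgood l.1 l.2) (by simpa [hB, hBlk, hlab] using h)
  -- blocks are placed polynomial local forms with `U` at the canonical placement of their supports
  have hrow' : ∀ (i : ι) (ρ : Perm (Fin n)), (∀ x ∈ R (L i), ρ x = x) →
      rename (fun P : Fin n × Fin n => (ρ P.1, P.2)) (L i) = L i := by
    intro i ρ hρ
    have h := hRfix i ρ hρ
    rw [vact_apply] at h
    have hf : (⇑(rowHom ρ) : Fin n × Fin n → Fin n × Fin n) = fun P => (ρ P.1, P.2) := funext (rowHom_apply ρ)
    rwa [hf] at h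
  have hcol' : ∀ (i : ι) (ρ : Perm (Fin n)), (∀ x ∈ S (L i), ρ x = x) →
      rename (fun P : Fin n × Fin n => (P.1, ρ P.2)) (L i) = L i := by
    intro i ρ hρ
    have h := hSfix i ρ hρ
    rw [vact_apply] at h
    have hf : (⇑(colHom ρ) : Fin n × Fin n → Fin n × Fin n) = fun P => (P.1, ρ P.2) := funext (colHom_apply ρ)
    rwa [hf] at h
  have hloc : ∀ l : J, ∃ (r c : ℕ) (eR : Fin r → Fin n) (eC : Fin c → Fin n)
      (P : MvPolynomial (((Fin r × Fin c) ⊕ (Fin r ⊕ Fin c)) ⊕ Unit) ℂ), r + c + 1 ≤ 2 * k - 1 ∧ Function.Injective eR ∧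
      Function.Injective eC ∧
      B l = aeval (Sum.elim (Sum.elim (fun ab : Fin r × Fin c => (X (eR ab.1, eC ab.2) : MvPolynomial (Fin n × Fin n) ℂ))
        (Sum.elim (fun a : Fin r => ∑ j : Fin n, (X (eR a, j) : MvPolynomial (Fin n × Fin n) ℂ))
          (fun b : Fin c => ∑ j : Fin n, (X (j, eC b) : MvPolynomial (Fin n × Fin n) ℂ))))
        (fun _ : Unit => ∑ i : Fin n, ∑ j : Fin n, (X (i, j) : MvPolynomial (Fin n × Fin n) ℂ))) P := by
    rintro ⟨⟨A, T⟩, hl⟩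
    have hl' := hl
    rw [hJ, Finset.mem_image] at hl'
    obtain ⟨i₀, -, hi₀⟩ := hl'
    have hA : R (L i₀) = A := congrArg Prod.fst hi₀
    have hT : S (L i₀) = T := congrArg Prod.snd hi₀
    -- every factor of the block is `aeval` of a polynomial at the canonical placement
    have hP : ∀ i : {i // lab (L i) = (A, T)}, ∃ P : MvPolynomial (((Fin A.card × Fin T.card) ⊕
        (Fin A.card ⊕ Fin T.card)) ⊕ Unit) ℂ,
        L i = aeval (Sum.elim (Sum.elim
          (fun ab : Fin A.card × Fin T.card =>
            (X (((A.equivFin.symm ab.1 : A) : Fin n), ((T.equivFin.symm ab.2 : T) : Fin n)) : MvPolynomial (Fin n × Fin n) ℂ))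
          (Sum.elim (fun a : Fin A.card => ∑ j : Fin n, (X (((A.equivFin.symm a : A) : Fin n), j) : MvPolynomial (Fin n × Fin n) ℂ))
            (fun b : Fin T.card => ∑ j : Fin n, (X (j, ((T.equivFin.symm b : T) : Fin n)) : MvPolynomial (Fin n × Fin n) ℂ))))
          (fun _ : Unit => ∑ i : Fin n, ∑ j : Fin n, (X (i, j) : MvPolynomial (Fin n × Fin n) ℂ))) P := by
      rintro ⟨i, hi⟩
      have hRi : R (L i) = A := congrArg Prod.fst hi
      have hSi : S (L i) = T := congrArg Prod.snd hi
      exact exists_polyU_eq_aeval_of_rowCol_invariant (L i) (hL1 i).le A T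
        (fun ρ hρ => hrow' i ρ (by rw [hRi]; exact hρ)) (fun ρ hρ => hcol' i ρ (by rw [hSi]; exact hρ))
    choose Pf hPf using hP
    refine ⟨A.card, T.card, fun a => ((A.equivFin.symm a : A) : Fin n), fun b => ((T.equivFin.symm b : T) : Fin n),
      ∏ i : {i // lab (L i) = (A, T)}, Pf i, ?_, ?_, ?_, ?_⟩
    · have h1 := hRk i₀
      have h2 := hSk i₀
      rw [hA] at h1
      rw [hT] at h2
      omega
    · intro a b h
      exact A.equivFin.symm.injective (Subtype.ext h)
    · intro a b h
      exact T.equivFin.symm.injective (Subtype.ext h)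
    · simp only [hB, hBlk]
      rw [map_prod, Finset.prod_subtype ((univ : Finset ι).filter fun i => lab (L i) = (A, T))
        (p := fun i => lab (L i) = (A, T)) (fun i => by simp) L]
      exact Fintype.prod_congr _ _ fun i => hPf i
  have hprod := prod_mem_narrowSpan_of_blockUntwisted n (2 * k - 1) B hB0 κ hassocB heigenB hloc
  -- reassemble
  have hf : (∏ i ∈ (univ : Finset ι).filter (fun i => Good (R (L i), S (L i))), L i) = ∏ l : J, B l := by
    have h1 : (∏ i ∈ (univ : Finset ι).filter (fun i => Good (R (L i), S (L i))), L i) =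
        ∏ i ∈ (univ : Finset ι).filter (fun i => Good (lab (L i))), L i := by simp only [hlab]
    rw [h1, hdecomp, hB, ← Finset.prod_coe_sort J]
  rw [hf]
  exact hprod

end NormalisedFactors

end Summit.ValiantsHypothesis.ValiantsHypothesis.Theorems

end
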